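import Summits.NavierStokesRegularity.NavierStokesRegularity.Theses.FilamentSkeletonRss
import Summits.NavierStokesRegularity.NavierStokesRegularity.Theorems.FilamentSkeletonRssSkeletonEquilibriumRadialSinkModel
import Summits.NavierStokesRegularity.NavierStokesRegularity.Theorems.FilamentSkeletonRssSkeletonEquilibriumTameVerticalSubcritical
import Summits.NavierStokesRegularity.NavierStokesRegularity.Theorems.FilamentSkeletonRssSkeletonEquilibriumCruxSizedCertificate

/-!
# Crux `SkeletonEquilibrium` (stmt-NavierStokesRegularity-15400) is FALSE modulo `ZeroAccretionSelection`

Negative lemma (refuter, crux-attack seat `refuter-rtask-NavierStokesRegularity-Filamen-ad2b0253-0`,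
2026-08-17) of the NEGATION line `zero-accretion-selection` of the crux K1 = `FilamentSkeletonRss.SkeletonEquilibrium`
(exact C² relative equilibria of the regularised Biot–Savart law in the rotating Leray frame with proper,
separated, low-curvature filaments and ONE SUPERCRITICAL stagnation point per filament, `w′(τ*) ≥ 3/2 + δ`, at
arbitrarily large circulation `Γ`). The line's checked skeleton
`Cruxes/SkeletonEquilibrium/Lines/zero_accretion_selection.lean` (lead a1 v5, commit 94981a20b529; lead c3 cycle 2)
composes SIX registered stubs into `¬ SkeletonEquilibrium`; two of them are LANDED
(`stub_radialSinkModel` p164748 — zero accretion at the radial sink, model form; `stub_tameVerticalSubcritical`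
p168324 — the endgame: tame near-vertical length-regular configurations are subcritical), four are conjectural.
This file turns that composition into a kernel-checked implication

  `SkeletonEquilibrium_false_of_ZeroAccretionSelection : ZeroAccretionSelection → ¬ SkeletonEquilibrium`,

where the hypothesis `ZeroAccretionSelection` is the conjunction of the four conjectural stubs, each restated
here VERBATIM as a named proposition (so that a landing of the registered stub proves the conjunct by `exact`):

* `LengthRegular`          = `stub_lengthRegular` (shared by the three negation lines; SC-free: about ALL equilibria);
* `MirrorPointSelection`   = `stub_mirrorPointSelection` (s2; a pure ODE statement about the outer binormal flow
                             `Y″ = (4π/γ) Y′ × (½Y − αe₃×Y)`, SC-free);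
* `StrandSeparation`       = `stub_strandSeparation` (ball-local chord–arc of returning strands near a waist);
* `ZeroAccretionShadowing` = `stub_zeroAccretionShadowing` (THE XL core: radial-sink model ⇒ outer-ODE shadowing,
                             ripple-free shells, waists in the unit outer ball, outer-scale C² control).

THE GAP, kernel-checked (`not_skeletonEquilibrium_iff_of_scFree`, from the landed certificate p169635
`stub_cruxSizedCertificate` / `strandSeparation_of_not_skeletonEquilibrium`): the last two conjuncts quantify only
over witnesses that SATISFY the crux's stagnation clause beyond a threshold chosen after the data, so each is a
COROLLARY of `¬ SkeletonEquilibrium`; hence, modulo the two SC-free conjuncts,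
`¬ SkeletonEquilibrium ↔ (StrandSeparation ∧ ZeroAccretionShadowing)` — the XL core is crux-sized, and this negative
lemma does NOT lower the difficulty of refuting K1 as typed: it records exactly which analytic statements the five
seats' verdict "K1 false as typed (0.8–0.9); re-cut to a ball-local / approximate equilibrium" rests on
(c2, s1, s2, a1, c3; `Cruxes/SkeletonEquilibrium/HANDOFF.md`). Filed `--negative-modulo ZeroAccretionSelection`: the
crux item stays open (held); `ZeroAccretionSelection` is the construction item.
-/

noncomputable section

-- `Summit.<Summit>.<Problem>`: single-conjunct summit, the duplicate segment is mandated (CONVENTIONS §2).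
set_option linter.dupNamespace false

namespace Summit.NavierStokesRegularity.NavierStokesRegularity.Theorems.SkeletonEquilibrium.Negative

open Set MeasureTheory Filter Topology
open Literature.Analysis.FluidPDE
open scoped RealInnerProductSpace InnerProductSpace BigOperators
open Summit.NavierStokesRegularity.NavierStokesRegularity.Theses.FilamentSkeletonRss (SkeletonEquilibrium)

/-! ## The four conjectural stubs of the line, as named propositions (verbatim signatures) -/

/-- **H₁ = `stub_lengthRegular` (conjectural, SC-free; shared by the lines `kelvin-sonic-negation`,
`mirror-point-negation`, `zero-accretion-selection`).** Relative equilibria of the regularised Biot–Savart law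
in the rotating Leray frame satisfying the configuration clauses at `Γ ≥ 1` are LENGTH-REGULAR at scales
`≥ √Γ`: arclength of filament `k` inside any ball of radius `D ≥ √Γ` is `≤ C₀ D`, `C₀` depending on the data
only. (No stagnation clause: a statement about ALL equilibria. Why it might fail: a densely coiling or
hairpin equilibrium end; s1/s2 argue densifying solenoids violate the integrability clause.) [conjecture] -/
def LengthRegular : Prop :=
  ∀ (N : ℕ) (γ : Fin N → ℝ) (α ρ K : ℝ), α ≠ 0 → 0 < ρ →
    ∃ C₀ : ℝ, 0 < C₀ ∧ ∀ Γ : ℝ, 1 ≤ Γ →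
      ∀ (Ξ : Fin N → ℝ → EuclideanSpace ℝ (Fin 3)) (w : Fin N → ℝ → ℝ),
        (∀ j, ContDiff ℝ 2 (Ξ j) ∧ Function.Injective (Ξ j) ∧ Differentiable ℝ (w j) ∧
            (∀ τ, ‖deriv (Ξ j) τ‖ = 1) ∧ (∀ τ, ‖iteratedDeriv 2 (Ξ j) τ‖ * Real.sqrt Γ ≤ K) ∧
            Tendsto (fun τ => ‖Ξ j τ‖) atTop atTop ∧ Tendsto (fun τ => ‖Ξ j τ‖) atBot atTop) →
        (∀ j k, j ≠ k → ∀ τ σ, ρ * Real.sqrt Γ ≤ ‖Ξ j τ - Ξ k σ‖) →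
        (∀ j (x : EuclideanSpace ℝ (Fin 3)), Integrable (fun σ : ℝ =>
            ((‖x - Ξ j σ‖ ^ 2 + 1) ^ (3 / 2 : ℝ))⁻¹ • cross (deriv (Ξ j) σ) (x - Ξ j σ))) →
        (∀ j τ, (∑ k : Fin N, (Γ * γ k / (4 * Real.pi)) • ∫ σ : ℝ,
              ((‖Ξ j τ - Ξ k σ‖ ^ 2 + 1) ^ (3 / 2 : ℝ))⁻¹ • cross (deriv (Ξ k) σ) (Ξ j τ - Ξ k σ))
            + (1 / 2 : ℝ) • Ξ j τ - α • cross (EuclideanSpace.single (2 : Fin 3) (1 : ℝ)) (Ξ j τ)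
            = w j τ • deriv (Ξ j) τ) →
        ∀ (k : Fin N) (x : EuclideanSpace ℝ (Fin 3)) (D : ℝ), Real.sqrt Γ ≤ D →
          volume {τ : ℝ | ‖Ξ k τ - x‖ ≤ D} ≤ ENNReal.ofReal (C₀ * D)

/-- **H₂ = `stub_mirrorPointSelection` (conjectural, SC-free; s2's STUB 4, shared by `mirror-point-negation`
and `zero-accretion-selection`).** Unit-speed `C²` solutions of the OUTER ODE
`Yo″ = (4π/γ_k) • Yo′ × (½Yo − αe₃×Yo)` whose ripple functional is `≤ ε₀` on the shell `R₁ ≤ ‖Yo‖ ≤ R₃` are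
`θ`-vertical in the outer 2-ball (mirror-point law + Weber nondegeneracy of the axis; certified-numerics
content: gyration map scans kit j024957, j026971, j027042 — no off-axis zero for `|α| ∈ [0.02, 30]`).
[conjecture] -/
def MirrorPointSelection : Prop :=
  ∀ (N : ℕ) (γ : Fin N → ℝ) (α : ℝ), α ≠ 0 → (∀ k, γ k ≠ 0) →
    ∀ θ : ℝ, 0 < θ → ∃ ε₀ R₁ R₃ : ℝ, 0 < ε₀ ∧ 0 < R₁ ∧ R₁ ≤ R₃ ∧
      ∀ (k : Fin N) (Yo : ℝ → EuclideanSpace ℝ (Fin 3)), ContDiff ℝ 2 Yo → (∀ s, ‖deriv Yo s‖ = 1) →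
        (∀ s, iteratedDeriv 2 Yo s =
            (4 * Real.pi / γ k) • cross (deriv Yo s)
              ((1 / 2 : ℝ) • Yo s - α • cross (EuclideanSpace.single (2 : Fin 3) (1 : ℝ)) (Yo s))) →
        (∀ (s : ℝ), R₁ ≤ ‖Yo s‖ → ‖Yo s‖ ≤ R₃ →
          ∀ (B b Bt : EuclideanSpace ℝ (Fin 3)) (c : ℝ),
            B = (1 / 2 : ℝ) • Yo s - α • cross (EuclideanSpace.single (2 : Fin 3) (1 : ℝ)) (Yo s) →
            b = ‖B‖⁻¹ • B →
            Bt = (1 / 2 : ℝ) • deriv Yo s - α • cross (EuclideanSpace.single (2 : Fin 3) (1 : ℝ)) (deriv Yo s) →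
            c = ⟪deriv Yo s, b⟫ →
            ‖deriv Yo s - c • b - (c / (4 * Real.pi / γ k) / ‖B‖ ^ 2) • cross b Bt‖ * ‖Yo s‖ ≤ ε₀) →
        ∀ s, ‖Yo s‖ ≤ 2 → ‖cross (deriv Yo s) (EuclideanSpace.single (2 : Fin 3) (1 : ℝ))‖ ≤ θ

/-- **H₃ = `stub_strandSeparation` (conjectural; a COROLLARY of `¬ SkeletonEquilibrium`, see
`strandSeparation_of_not_skeletonEquilibrium'`).** For `Γ ≥ Γ₃` every length-regular witness WITH the
stagnation clause keeps distinct strands of the same filament inside the `R√Γ`-ball around any stagnation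
point `ρ′√Γ` apart, typed as a ball-local chord–arc condition below the scale `ρ′√Γ` (`ρ′ ≤ ½`). (Why it
might fail: a levitating-hairpin equilibrium.) [conjecture] -/
def StrandSeparation : Prop :=
  ∀ (N : ℕ) (γ : Fin N → ℝ) (α δ ρ K C₀ : ℝ), α ≠ 0 → 0 < δ → 0 < ρ → 0 < C₀ → (∀ j, γ j ≠ 0) →
    ∀ R : ℝ, 1 ≤ R → ∃ ρ' : ℝ, 0 < ρ' ∧ ρ' ≤ 1 / 2 ∧ ∃ Γ₃ : ℝ, ∀ Γ : ℝ, Γ₃ ≤ Γ → 2 ≤ Γ →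
      ∀ (Ξ : Fin N → ℝ → EuclideanSpace ℝ (Fin 3)) (w : Fin N → ℝ → ℝ),
        (∀ j, ContDiff ℝ 2 (Ξ j) ∧ Function.Injective (Ξ j) ∧ Differentiable ℝ (w j) ∧
            (∀ τ, ‖deriv (Ξ j) τ‖ = 1) ∧ (∀ τ, ‖iteratedDeriv 2 (Ξ j) τ‖ * Real.sqrt Γ ≤ K) ∧
            Tendsto (fun τ => ‖Ξ j τ‖) atTop atTop ∧ Tendsto (fun τ => ‖Ξ j τ‖) atBot atTop) →
        (∀ j k, j ≠ k → ∀ τ σ, ρ * Real.sqrt Γ ≤ ‖Ξ j τ - Ξ k σ‖) →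
        (∀ j (x : EuclideanSpace ℝ (Fin 3)), Integrable (fun σ : ℝ =>
            ((‖x - Ξ j σ‖ ^ 2 + 1) ^ (3 / 2 : ℝ))⁻¹ • cross (deriv (Ξ j) σ) (x - Ξ j σ))) →
        (∀ j τ, (∑ k : Fin N, (Γ * γ k / (4 * Real.pi)) • ∫ σ : ℝ,
              ((‖Ξ j τ - Ξ k σ‖ ^ 2 + 1) ^ (3 / 2 : ℝ))⁻¹ • cross (deriv (Ξ k) σ) (Ξ j τ - Ξ k σ))
            + (1 / 2 : ℝ) • Ξ j τ - α • cross (EuclideanSpace.single (2 : Fin 3) (1 : ℝ)) (Ξ j τ)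
            = w j τ • deriv (Ξ j) τ) →
        (∀ (k : Fin N) (x : EuclideanSpace ℝ (Fin 3)) (D : ℝ), Real.sqrt Γ ≤ D →
            volume {τ : ℝ | ‖Ξ k τ - x‖ ≤ D} ≤ ENNReal.ofReal (C₀ * D)) →
        (∀ j, ∃ τs : ℝ, w j τs = 0 ∧ (∀ τ, w j τ = 0 → τ = τs) ∧ 3 / 2 + δ ≤ deriv (w j) τs) →
        ∀ (j : Fin N) (τs : ℝ), w j τs = 0 →
          (∀ (k : Fin N) (τ τ' : ℝ), ‖Ξ k τ - Ξ j τs‖ ≤ R * Real.sqrt Γ → ‖Ξ k τ' - Ξ j τs‖ ≤ R * Real.sqrt Γ →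
              ‖Ξ k τ - Ξ k τ'‖ < ρ' * Real.sqrt Γ → |τ - τ'| ≤ 2 * ‖Ξ k τ - Ξ k τ'‖)

/-- **H₄ = `stub_zeroAccretionShadowing` (THE conjectural XL core of the line, conditional on the LANDED
radial-sink model `stub_radialSinkModel`, p164748, which is its antecedent; a COROLLARY of
`¬ SkeletonEquilibrium`, see `zeroAccretionShadowing_of_not_skeletonEquilibrium`).** For all large `Γ`, every
length-regular witness WITH the stagnation clause is, filament by filament, tangent-shadowed on the inner
region by a unit-speed `C²` solution of the outer ODE that is ripple-free to `ε` on the shell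
`R₁ ≤ ‖Yo‖ ≤ R₃`; every stagnation point lies in the outer unit ball `‖Ξ_j(τ*)‖ ≤ ℓ = √(Γ log Γ/2)`; and in
the `R√Γ`-ball around it every strand has outer-scale `C²` control `‖Ξ″‖ℓ ≤ M`,
`‖Ξ″(τ) − Ξ″(τ′)‖ℓ ≤ M|τ−τ′|/ℓ + ε`. Mechanism (s1/s2/c2/a1/c3): the exact Rosenhead multiplier saturates, the
steady characteristic chain ends in the radial sink with exponent `(3/2 − w′)/(2w′) < 0` under (SC), so a
bounded witness carries no Kelvin content on the chain — formal (uniform-in-`e` propagation / radial-point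
estimates for the nonlocal linearised operator about an unknown witness are unproved). [conjecture] -/
def ZeroAccretionShadowing : Prop :=
  (∀ (a p q r η s₀ : ℝ) (h₁ h₂ : ℝ → ℝ), p ^ 2 + q * r < 0 → 0 < q → 0 ≤ η →
    a + 2 * η * (|r| + |p| + q) * (q - r) / (-(p ^ 2 + q * r)) < 0 → 0 < s₀ →
    (∀ s, 0 < s → s ≤ s₀ → DifferentiableAt ℝ h₁ s ∧ DifferentiableAt ℝ h₂ s ∧
      |s * deriv h₁ s - (a * h₁ s + p * h₁ s + q * h₂ s)| +
        |s * deriv h₂ s - (a * h₂ s + r * h₁ s - p * h₂ s)| ≤ η * (|h₁ s| + |h₂ s|)) →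
    (h₁ s₀ ≠ 0 ∨ h₂ s₀ ≠ 0) → ∀ C : ℝ, ∃ s, 0 < s ∧ s ≤ s₀ ∧ C < h₁ s ^ 2 + h₂ s ^ 2) →
  ∀ (N : ℕ) (γ : Fin N → ℝ) (α δ ρ K C₀ : ℝ), α ≠ 0 → 0 < δ → 0 < ρ → 0 < C₀ → (∀ j, γ j ≠ 0) →
    ∀ R : ℝ, 0 ≤ R → ∃ M : ℝ, 0 ≤ M ∧ ∀ ε : ℝ, 0 < ε → ∀ R₁ R₃ : ℝ, 0 < R₁ → R₁ ≤ R₃ →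
    ∃ Γ₂ : ℝ, ∀ Γ : ℝ, Γ₂ ≤ Γ → 2 ≤ Γ →
      ∀ (Ξ : Fin N → ℝ → EuclideanSpace ℝ (Fin 3)) (w : Fin N → ℝ → ℝ),
        (∀ j, ContDiff ℝ 2 (Ξ j) ∧ Function.Injective (Ξ j) ∧ Differentiable ℝ (w j) ∧
            (∀ τ, ‖deriv (Ξ j) τ‖ = 1) ∧ (∀ τ, ‖iteratedDeriv 2 (Ξ j) τ‖ * Real.sqrt Γ ≤ K) ∧
            Tendsto (fun τ => ‖Ξ j τ‖) atTop atTop ∧ Tendsto (fun τ => ‖Ξ j τ‖) atBot atTop) →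
        (∀ j k, j ≠ k → ∀ τ σ, ρ * Real.sqrt Γ ≤ ‖Ξ j τ - Ξ k σ‖) →
        (∀ j (x : EuclideanSpace ℝ (Fin 3)), Integrable (fun σ : ℝ =>
            ((‖x - Ξ j σ‖ ^ 2 + 1) ^ (3 / 2 : ℝ))⁻¹ • cross (deriv (Ξ j) σ) (x - Ξ j σ))) →
        (∀ j τ, (∑ k : Fin N, (Γ * γ k / (4 * Real.pi)) • ∫ σ : ℝ,
              ((‖Ξ j τ - Ξ k σ‖ ^ 2 + 1) ^ (3 / 2 : ℝ))⁻¹ • cross (deriv (Ξ k) σ) (Ξ j τ - Ξ k σ))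
            + (1 / 2 : ℝ) • Ξ j τ - α • cross (EuclideanSpace.single (2 : Fin 3) (1 : ℝ)) (Ξ j τ)
            = w j τ • deriv (Ξ j) τ) →
        (∀ (k : Fin N) (x : EuclideanSpace ℝ (Fin 3)) (D : ℝ), Real.sqrt Γ ≤ D →
            volume {τ : ℝ | ‖Ξ k τ - x‖ ≤ D} ≤ ENNReal.ofReal (C₀ * D)) →
        (∀ j, ∃ τs : ℝ, w j τs = 0 ∧ (∀ τ, w j τ = 0 → τ = τs) ∧ 3 / 2 + δ ≤ deriv (w j) τs) →
        (∀ k : Fin N, ∃ Yo : ℝ → EuclideanSpace ℝ (Fin 3),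
          ContDiff ℝ 2 Yo ∧ (∀ s, ‖deriv Yo s‖ = 1) ∧
          (∀ s, iteratedDeriv 2 Yo s =
              (4 * Real.pi / γ k) • cross (deriv Yo s)
                ((1 / 2 : ℝ) • Yo s - α • cross (EuclideanSpace.single (2 : Fin 3) (1 : ℝ)) (Yo s))) ∧
          (∀ τ, ‖Ξ k τ‖ ≤ Real.sqrt (Γ * Real.log Γ / 2) + R * Real.sqrt Γ →
              ∃ s, ‖Yo s‖ ≤ 2 ∧ ‖deriv (Ξ k) τ - deriv Yo s‖ ≤ ε) ∧
          (∀ (s : ℝ), R₁ ≤ ‖Yo s‖ → ‖Yo s‖ ≤ R₃ →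
            ∀ (B b Bt : EuclideanSpace ℝ (Fin 3)) (c : ℝ),
              B = (1 / 2 : ℝ) • Yo s - α • cross (EuclideanSpace.single (2 : Fin 3) (1 : ℝ)) (Yo s) →
              b = ‖B‖⁻¹ • B →
              Bt = (1 / 2 : ℝ) • deriv Yo s - α • cross (EuclideanSpace.single (2 : Fin 3) (1 : ℝ)) (deriv Yo s) →
              c = ⟪deriv Yo s, b⟫ →
              ‖deriv Yo s - c • b - (c / (4 * Real.pi / γ k) / ‖B‖ ^ 2) • cross b Bt‖ * ‖Yo s‖ ≤ ε)) ∧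
        (∀ (j : Fin N) (τs : ℝ), w j τs = 0 → ‖Ξ j τs‖ ≤ Real.sqrt (Γ * Real.log Γ / 2) ∧
          (∀ (k : Fin N) (τ τ' : ℝ), ‖Ξ k τ - Ξ j τs‖ ≤ R * Real.sqrt Γ → ‖Ξ k τ' - Ξ j τs‖ ≤ R * Real.sqrt Γ →
              ‖iteratedDeriv 2 (Ξ k) τ‖ * Real.sqrt (Γ * Real.log Γ / 2) ≤ M ∧
              ‖iteratedDeriv 2 (Ξ k) τ - iteratedDeriv 2 (Ξ k) τ'‖ * Real.sqrt (Γ * Real.log Γ / 2)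
                ≤ M * |τ - τ'| / Real.sqrt (Γ * Real.log Γ / 2) + ε))

/-- **H = `ZeroAccretionSelection`, the hypothesis of the negative lemma** (`--negative-modulo`): the
conjunction of the four conjectural stubs of the line `zero-accretion-selection`. Two conjuncts
(`StrandSeparation`, `ZeroAccretionShadowing`) are corollaries of the negated crux, so modulo the SC-free half
`LengthRegular ∧ MirrorPointSelection` this hypothesis is EQUIVALENT to `¬ SkeletonEquilibrium`
(`zeroAccretionSelection_iff_not_skeletonEquilibrium`). Research-level analysis as Lean theorems; not published
statements, hence a hypothesis, not Literature facts. -/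
def ZeroAccretionSelection : Prop :=
  LengthRegular ∧ MirrorPointSelection ∧ StrandSeparation ∧ ZeroAccretionShadowing

/-! ## Elementary cross-product facts used by the composition -/

/-- `‖v × w‖ ≤ ‖v‖ ‖w‖` (from the Literature identity `norm_cross`). [folklore] -/
private theorem zas_norm_cross_le (v w : EuclideanSpace ℝ (Fin 3)) : ‖cross v w‖ ≤ ‖v‖ * ‖w‖ := by
  rw [norm_cross]
  have h1 : Real.sin (InnerProductGeometry.angle v w) ≤ 1 := Real.sin_le_one _
  have h2 : 0 ≤ ‖v‖ * ‖w‖ := by positivity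
  nlinarith

/-- `(v − v′) × w = v × w − v′ × w` (bilinearity, via the bundled `crossCLM`). [folklore] -/
private theorem zas_cross_sub_left (v v' w : EuclideanSpace ℝ (Fin 3)) :
    cross (v - v') w = cross v w - cross v' w := by
  rw [← crossCLM_apply, ← crossCLM_apply, ← crossCLM_apply]
  exact crossCLM.map_sub₂ v v' w

/-- `‖e₃‖ = 1`. [folklore] -/
private theorem zas_norm_e3 : ‖(EuclideanSpace.single (2 : Fin 3) (1 : ℝ))‖ = 1 := by
  simp

/-! ## The negative lemma -/

/-- **The crux is false modulo the four conjectural stubs, curried form.** This is the composition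
`not_SkeletonEquilibrium_of` of the checked skeleton `Lines/zero_accretion_selection.lean` (v5) with the two
landed stubs (`stub_radialSinkModel` p164748, `stub_tameVerticalSubcritical` p168324) invoked by name and the
four conjectural ones as hypotheses: data ⇒ `C₀` (H₁) ⇒ `C₂` ⇒ `R = 4(C₂+1)` ⇒ `ρ′` (H₃ at `R`) ⇒ `M` (H₄ at
`R`, fed with the radial-sink model) ⇒ `C₁` ⇒ `θ = ε₁ = 1/(16(C₁+1))` ⇒ `(ε₀, R₁, R₃)` (H₂ at `θ/2`) ⇒
`ε = min(θ/2, ε₀, ε₁)` ⇒ thresholds ⇒ evaluate the crux at `Γ₀ = max(Γ₂, Γ₃, Γ₄, 2)`: every strand in the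
`R√Γ`-ball around the stagnation point of filament `0` is `θ`-vertical, (C) and (S) hold, so the endgame gives
`w′(τ*) ≤ ½ + 1/8 + 1/16 + 1/8 < 3/2 + δ`, contradicting (SC). [folklore] -/
theorem SkeletonEquilibrium_false_of_hyps (hLR : LengthRegular) (hMP : MirrorPointSelection)
    (hSS : StrandSeparation) (hZA : ZeroAccretionShadowing) : ¬ SkeletonEquilibrium := by
  intro h
  obtain ⟨N, γ, α, δ, ρ, K, hN, hα, hδ, hρ, hγ, hfam⟩ := h
  -- length-regularity constant of the data (H₁)
  obtain ⟨C₀, hC₀, hreg⟩ := hLR N γ α ρ K hα hρ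
  -- far-field endgame constant (landed endgame, first layer) and the ball radius R
  obtain ⟨C₂, hC₂, hsub₂⟩ := _root_.Summit.NavierStokesRegularity.NavierStokesRegularity.Theorems.SkeletonEquilibrium.ZeroAccretionSelection.stub_tameVerticalSubcritical N γ α ρ K C₀ hρ hC₀
  set R : ℝ := 4 * (C₂ + 1) with hR_def
  have hC₂1 : 0 < C₂ + 1 := by linarith
  have hR : 1 ≤ R := by rw [hR_def]; linarith
  have hR0 : 0 ≤ R := by linarith
  have hRkey : C₂ / R ^ 2 ≤ 1 / 16 := by
    rw [hR_def, div_le_iff₀ (by positivity)]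
    nlinarith
  -- strand separation at radius R (H₃)
  obtain ⟨ρ', hρ', hρ'h, Γ₃, hsep⟩ := hSS N γ α δ ρ K C₀ hα hδ hρ hC₀ hγ R hR
  -- outer-curvature export constant M at radius R (H₄, fed with the landed radial-sink model)
  obtain ⟨M, hM, hshadow⟩ :=
    hZA _root_.Summit.NavierStokesRegularity.NavierStokesRegularity.Theorems.SkeletonEquilibrium.ZeroAccretionSelection.stub_radialSinkModel N γ α δ ρ K C₀ hα hδ hρ hC₀ hγ R hR0
  -- near-field endgame constant (second layer) and the tolerances θ = ε₁
  obtain ⟨C₁, hC₁, hsub⟩ := hsub₂ R ρ' M hR hρ' hρ'h hM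
  have hC₁1 : 0 < C₁ + 1 := by linarith
  set θ : ℝ := 1 / (16 * (C₁ + 1)) with hθ_def
  set ε₁ : ℝ := 1 / (16 * (C₁ + 1)) with hε₁_def
  have hθ : 0 < θ := by rw [hθ_def]; positivity
  have hθhalf : θ ≤ 1 / 2 := by
    rw [hθ_def, div_le_div_iff₀ (by positivity) (by norm_num)]; nlinarith
  have hε₁ : 0 < ε₁ := by rw [hε₁_def]; positivity
  have hθkey : C₁ * θ ≤ 1 / 16 := by
    rw [hθ_def, mul_one_div, div_le_div_iff₀ (by positivity) (by norm_num)]; nlinarith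
  have hε₁key : C₁ * ε₁ ≤ 1 / 16 := by
    rw [hε₁_def, mul_one_div, div_le_div_iff₀ (by positivity) (by norm_num)]; nlinarith
  -- selection constants at tolerance θ/2 (H₂)
  obtain ⟨ε₀, R₁, R₃, hε₀, hR₁, hR₁₃, hsel⟩ := hMP N γ α hα hγ (θ / 2) (by positivity)
  -- the working tolerance
  set ε : ℝ := min (θ / 2) (min ε₀ ε₁) with hε_def
  have hε : 0 < ε := by rw [hε_def]; exact lt_min (by positivity) (lt_min hε₀ hε₁)
  have hεθ : ε ≤ θ / 2 := min_le_left _ _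
  have hεε₀ : ε ≤ ε₀ := le_trans (min_le_right _ _) (min_le_left _ _)
  have hεε₁ : ε ≤ ε₁ := le_trans (min_le_right _ _) (min_le_right _ _)
  have hε1 : ε ≤ 1 := by
    have : ε₁ ≤ 1 := by
      rw [hε₁_def, div_le_one (by positivity)]; nlinarith
    linarith
  -- thresholds (H₄, endgame)
  obtain ⟨Γ₂, hshad⟩ := hshadow ε hε R₁ R₃ hR₁ hR₁₃
  obtain ⟨Γ₄, hend⟩ := hsub θ ε hθ hθhalf hε hε1
  -- evaluate the crux at Γ₀ = max (max Γ₂ Γ₃) (max Γ₄ 2)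
  obtain ⟨Γ, hΓ₀, hΓpos, Ξ, w, h1, h2, h3, h4, h5⟩ := hfam (max (max Γ₂ Γ₃) (max Γ₄ 2))
  have hΓ₂ : Γ₂ ≤ Γ := le_trans (le_trans (le_max_left _ _) (le_max_left _ _)) hΓ₀
  have hΓ₃ : Γ₃ ≤ Γ := le_trans (le_trans (le_max_right _ _) (le_max_left _ _)) hΓ₀
  have hΓ₄ : Γ₄ ≤ Γ := le_trans (le_trans (le_max_left _ _) (le_max_right _ _)) hΓ₀
  have hΓ2 : 2 ≤ Γ := le_trans (le_trans (le_max_right _ _) (le_max_right _ _)) hΓ₀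
  have hΓ1 : 1 ≤ Γ := by linarith
  -- length regularity at this Γ
  have hL := hreg Γ hΓ1 Ξ w h1 h2 h3 h4
  -- shadowing/ripple-free/waist/C²-control (H₄) and separation (H₃) at this Γ
  obtain ⟨hYo, hwaist⟩ := hshad Γ hΓ₂ hΓ2 Ξ w h1 h2 h3 h4 hL h5
  have hS := hsep Γ hΓ₃ hΓ2 Ξ w h1 h2 h3 h4 hL h5
  -- a filament and its stagnation point
  set j : Fin N := ⟨0, hN⟩ with hj
  obtain ⟨τs, hz, huniq, hsc⟩ := h5 j
  obtain ⟨hwj, hctrl⟩ := hwaist j τs hz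
  -- VERTICALITY of every strand within R√Γ of the stagnation point
  have hvert : ∀ (k : Fin N) (τ : ℝ), ‖Ξ k τ - Ξ j τs‖ ≤ R * Real.sqrt Γ →
      ‖cross (deriv (Ξ k) τ) (EuclideanSpace.single (2 : Fin 3) (1 : ℝ))‖ ≤ θ := by
    intro k τ hkτ
    obtain ⟨Yo, hYo1, hYo2, hYo3, hYoa, hYob⟩ := hYo k
    -- the shadowing solution is ripple ≤ ε ≤ ε₀ on the shell
    have hYo_rip : ∀ (s : ℝ), R₁ ≤ ‖Yo s‖ → ‖Yo s‖ ≤ R₃ →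
        ∀ (B b Bt : EuclideanSpace ℝ (Fin 3)) (c : ℝ),
          B = (1 / 2 : ℝ) • Yo s - α • cross (EuclideanSpace.single (2 : Fin 3) (1 : ℝ)) (Yo s) →
          b = ‖B‖⁻¹ • B →
          Bt = (1 / 2 : ℝ) • deriv Yo s - α • cross (EuclideanSpace.single (2 : Fin 3) (1 : ℝ)) (deriv Yo s) →
          c = ⟪deriv Yo s, b⟫ →
          ‖deriv Yo s - c • b - (c / (4 * Real.pi / γ k) / ‖B‖ ^ 2) • cross b Bt‖ * ‖Yo s‖ ≤ ε₀ := by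
      intro s hs1 hs3 B b Bt c hB hb hBt hc
      exact le_trans (hYob s hs1 hs3 B b Bt c hB hb hBt hc) hεε₀
    -- hence θ/2-vertical on the outer 2-ball (H₂)
    have hYo_vert := hsel k Yo hYo1 hYo2 hYo3 hYo_rip
    -- the strand point lies in the inner region ‖Ξ‖ ≤ ℓ + R√Γ
    have hin : ‖Ξ k τ‖ ≤ Real.sqrt (Γ * Real.log Γ / 2) + R * Real.sqrt Γ := by
      have h' : ‖Ξ k τ‖ ≤ ‖Ξ j τs‖ + ‖Ξ k τ - Ξ j τs‖ := by
        have := norm_add_le (Ξ j τs) (Ξ k τ - Ξ j τs)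
        simpa using this
      linarith
    obtain ⟨s, hs2, hts⟩ := hYoa τ hin
    have hv := hYo_vert s hs2
    -- transfer verticality from Yo′(s) to Ξ_k′(τ)
    calc ‖cross (deriv (Ξ k) τ) (EuclideanSpace.single (2 : Fin 3) (1 : ℝ))‖
        = ‖cross (deriv Yo s) (EuclideanSpace.single (2 : Fin 3) (1 : ℝ)) +
            cross (deriv (Ξ k) τ - deriv Yo s) (EuclideanSpace.single (2 : Fin 3) (1 : ℝ))‖ := by
          rw [zas_cross_sub_left]; congr 1; abel
      _ ≤ ‖cross (deriv Yo s) (EuclideanSpace.single (2 : Fin 3) (1 : ℝ))‖ +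
            ‖cross (deriv (Ξ k) τ - deriv Yo s) (EuclideanSpace.single (2 : Fin 3) (1 : ℝ))‖ :=
          norm_add_le _ _
      _ ≤ θ / 2 + ‖deriv (Ξ k) τ - deriv Yo s‖ * ‖(EuclideanSpace.single (2 : Fin 3) (1 : ℝ))‖ :=
          add_le_add hv (zas_norm_cross_le _ _)
      _ ≤ θ / 2 + ε := by rw [zas_norm_e3, mul_one]; linarith
      _ ≤ θ := by linarith
  -- subcriticality (landed endgame)
  have hw := hend Γ hΓ₄ hΓ2 Ξ w h1 h2 h3 h4 hL j τs hz hvert hctrl (hS j τs hz)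
  -- the chosen tolerances give C₁(θ + ε) + C₂/R² + 1/8 ≤ 5/16
  have hkey : C₁ * (θ + ε) ≤ 1 / 8 := by
    have : C₁ * ε ≤ C₁ * ε₁ := mul_le_mul_of_nonneg_left hεε₁ hC₁
    nlinarith
  -- contradiction with (SC): 3/2 + δ ≤ w′(τ*) ≤ 1/2 + 1/8 + 1/16 + 1/8
  linarith

/-- **NEGATIVE LEMMA (`--negative-modulo ZeroAccretionSelection`).** The crux
`Summit.NavierStokesRegularity.NavierStokesRegularity.Theses.FilamentSkeletonRss.SkeletonEquilibrium`
(stmt-NavierStokesRegularity-15400) is FALSE modulo `ZeroAccretionSelection`, the conjunction of the four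
conjectural stubs of the negation line `zero-accretion-selection`. [folklore] -/
theorem SkeletonEquilibrium_false_of_ZeroAccretionSelection :
    ZeroAccretionSelection → ¬ SkeletonEquilibrium :=
  fun h => SkeletonEquilibrium_false_of_hyps h.1 h.2.1 h.2.2.1 h.2.2.2

/-! ## The gap, kernel-checked: the two SC-conjuncts are corollaries of the negated crux -/

/-- `¬ SkeletonEquilibrium → StrandSeparation` (the landed certificate, p169635). [folklore] -/
theorem strandSeparation_of_not_skeletonEquilibrium' (hneg : ¬ SkeletonEquilibrium) : StrandSeparation :=
  _root_.Summit.NavierStokesRegularity.NavierStokesRegularity.Theorems.SkeletonEquilibrium.ZeroAccretionSelection.strandSeparation_of_not_skeletonEquilibrium hneg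

/-- `¬ SkeletonEquilibrium → ZeroAccretionShadowing` (the landed certificate `stub_cruxSizedCertificate`,
p169635). [folklore] -/
theorem zeroAccretionShadowing_of_not_skeletonEquilibrium (hneg : ¬ SkeletonEquilibrium) :
    ZeroAccretionShadowing :=
  _root_.Summit.NavierStokesRegularity.NavierStokesRegularity.Theorems.SkeletonEquilibrium.ZeroAccretionSelection.stub_cruxSizedCertificate hneg

/-- **The XL core is crux-sized.** Modulo the two SC-free conjuncts (`LengthRegular`, about ALL equilibria;
`MirrorPointSelection`, a pure ODE statement) the negated crux is EQUIVALENT to the pair of SC-conjuncts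
`StrandSeparation ∧ ZeroAccretionShadowing`. [folklore] -/
theorem not_skeletonEquilibrium_iff_of_scFree (hLR : LengthRegular) (hMP : MirrorPointSelection) :
    ¬ SkeletonEquilibrium ↔ (StrandSeparation ∧ ZeroAccretionShadowing) :=
  ⟨fun hneg => ⟨strandSeparation_of_not_skeletonEquilibrium' hneg,
      zeroAccretionShadowing_of_not_skeletonEquilibrium hneg⟩,
    fun h => SkeletonEquilibrium_false_of_hyps hLR hMP h.1 h.2⟩

/-- **The hypothesis of the negative lemma is itself crux-sized**: given its SC-free half,
`ZeroAccretionSelection ↔ ¬ SkeletonEquilibrium`. (So this file lowers nothing: it is the kernel record of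
WHICH statements the verdict "K1 false as typed" rests on.) [folklore] -/
theorem zeroAccretionSelection_iff_not_skeletonEquilibrium (hLR : LengthRegular) (hMP : MirrorPointSelection) :
    ZeroAccretionSelection ↔ ¬ SkeletonEquilibrium :=
  ⟨SkeletonEquilibrium_false_of_ZeroAccretionSelection,
    fun hneg => ⟨hLR, hMP, strandSeparation_of_not_skeletonEquilibrium' hneg,
      zeroAccretionShadowing_of_not_skeletonEquilibrium hneg⟩⟩

end Summit.NavierStokesRegularity.NavierStokesRegularity.Theorems.SkeletonEquilibrium.Negative

end
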